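import Summits.AtomisticToContinuum.Crystallization.Theorems.ChargedEnergyGapTwinWallsLink

/-!
# `ChargedEnergyGap` — TWIN ROWS, part P-H (1/2): the in-layer hexagon, frame-free ROWS through wall sites, row ends are
# unclean, per-step straightness `2θ`; the two-payer corner inequality and the flatness / bending numerals of the record
# (cell `decomp-a2c`, lens 3, generation 60, node «RowsAndCorners»; over P-G `…Theorems.ChargedEnergyGapTwinWalls(Link)` by
# their future tree names)

WHAT NODE 60 ADDS BENEATH (N𝄪) `LocalSeamReductionW` (P-D, node of record 56L) — theorems only, no hypothesis, no dial; §1–§3 in THIS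
file, §4–§6 in `…Theorems.ChargedEnergyGapTwinRowsRecord` (P-H (2/2)):

 §1 HEXAGON CERTIFICATES (integer model, `decide`): the equator of the HCP pattern is closed under `u ↦ −u`; `u` and `−u`
    do not touch and have NO COMMON TOUCHER in the shell; conversely a shell vector `w ≠ u` not touching `u` and sharing
    no toucher with `u` IS `−u` (`oppInt_iff`) — the 120° second neighbours share a toucher (`commonToucher_needed`, the
    clause is load-bearing); each equatorial vector touches exactly two equatorial vectors; three antipodal pairs.
 §2 SLOT OCCUPANTS of a clean hcp-framed site (`θ ≤ 19/100`): the site within `θ` of a framed model vector `u` is a bond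
    neighbour whose LABEL is `u` (`label_of_near`); one occupant per slot (`eq_of_near`), one slot per occupant
    (`vec_eq_of_near`); occupants of slots `u, u'` are bonded iff `u, u'` touch (`adj_iff_touchInt_of_near`) — the
    in-layer HEXAGON of a wall site is an induced `6`-cycle of `bonds Q`.
 §3 ROWS.  `IsAntipode Q q p r` — read in the BOND GRAPH ALONE (no chart, no frame): `p, r` are bond neighbours of `q`,
    distinct, not bonded, with no common bond neighbour among the neighbours of `q`.  THEOREM (`isAntipode_iff_near_neg`):
    for a wall pair `p q` (`WallAdj`), in every hcp frame of `q` with `p` at slot `u`, the antipodes of `p` at `q` are EXACTLY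
    the occupants of slot `−u`.  Hence: a row successor EXISTS (`exists_isAntipode`), is UNIQUE (`isAntipode_unique`), is
    co-layered after `q` (`equatorial_of_isAntipode`), and is EITHER a wall site (`WallAdj q r`) OR UNCLEAN
    (`row_dichotomy`, `not_cleanAt_of_row_end` = (E3) along rows: ROWS END ONLY AT CHARGED OR UNCHARTED SITES).  This is the
    «layer-row incidence» of K-60a at Q-level over P-G only (critic row 1095 (K-iii)); its must-fail (cleanliness of the wall
    side) is `check/MustFail60.lean` M2.
 §4 STRAIGHTNESS PER STEP: `‖shellCoord q p + shellCoord q r‖ ≤ 2θ` (`norm_add_le_of_isAntipode`; absolute form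
    `midpoint_deviation_of_isAntipode`): `q` is within `θ·nn(q)` of the midpoint of its row neighbours.  This is ALL the
    `θ`-charts give (sharp: occupants may sit anywhere in their `θ`-discs) — a per-step bend of up to `2θ = 0.3 rad` is
    chart-consistent, so chart geometry alone certifies NO flatness at territory scale (`record_theta_drift_useless`);
    (K-i) is therefore routed as a PRICING line (memo §4, numerals §5 here), not as a chart-rigidity lemma.
 §5 RECORD NUMERALS (K-60b′, (K-i)): the TWO-PAYER dihedral-corner inequality `9·Cχ·M₂ ≤ f·b₂·M₂ + κ·c₁/3`
    (`record_corner_two_payer`: at the record `Cχ = 10⁻⁵`, w-mass `M₂ = 68` per unit edge length, it holds whenever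
    `κ ≥ 37/100 − (29/100)·f`, `f` = fcc-interior fraction of the sector's weighted mass, `κ` = θ-ROBUST gross sites per unit
    edge length; census GROSS-56 floor `2.05`), that surplus alone does NOT pay at the record (`record_corner_not_selfpaying`,
    must-fail M4), the `Cχ`-dial margins, the flatness share of the proximity halo (`record_flatness_halo`; must-fail M5),
    and the (K-i) pricing numerals: the μ₀-certified ELASTIC branch `bend_pays_zones_of_thick` (thickness `h² ≥ (30/7)·R` pays the
    refinement zones; sharp: `record_bend_threshold`, must-fail M7), the coherence caps, and the FACE branch for thin slabs
    (`record_face_pays`: core faces pay by slack; other-gross faces need the existential `C₁ ≥ 105/10⁴` — UNDECIDED, ask BEND-60).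
 §6 Record instances at `θ = 3/20`.

No `sorry`, no axiom, no instance, no notation, no `set_option`; `decide` only on the closed integer models.
-/

open Literature.MathematicalPhysics.StatisticalMechanics
open Literature.Geometry.DiscreteGeometry
open Summit.AtomisticToContinuum.Crystallization.Theses.PricedLinkCensus
open Summit.AtomisticToContinuum.Crystallization.Theorems.ChargedEnergyGapNegative

namespace Summit.AtomisticToContinuum.Crystallization.Theorems.ChargedEnergyGapChartDial

section TwinRows

/-! ## §1 Hexagon certificates of the integer HCP model -/

/-- The equator is closed under antipodes. -/
theorem neg_mem_hcpEquatorInt : ∀ u ∈ hcpEquatorInt, -u ∈ hcpEquatorInt := by decide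

/-- … so antipodes of equatorial vectors are model vectors. -/
theorem neg_mem_hcpInt : ∀ u ∈ hcpEquatorInt, -u ∈ hcpInt :=
  fun u hu => hcpEquatorInt_subset (neg_mem_hcpEquatorInt u hu)

/-- An equatorial vector is not its own antipode. -/
theorem neg_ne_self_of_mem_hcpEquatorInt : ∀ u ∈ hcpEquatorInt, -u ≠ u := by decide

/-- ★ Antipodal equatorial vectors do not touch (distance `2`, squared norm `72 ≠ 18`). -/
theorem not_touchInt_neg : ∀ u ∈ hcpEquatorInt, ¬ TouchInt 18 u (-u) := by decide

/-- ★ … and have NO COMMON TOUCHER in the shell: no model vector touches both `u` and `−u`. -/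
theorem touchInt_neg_disjoint : ∀ u ∈ hcpEquatorInt, ∀ z ∈ hcpInt, TouchInt 18 u z → ¬ TouchInt 18 (-u) z := by decide

/-- ★★ ANTIPODE CERTIFICATE: among the shell vectors, `−u` is THE vector other than `u`, not touching `u`, sharing no
toucher with `u` (the two 120° equatorial vectors and the four far polar vectors each share a toucher with `u`). -/
theorem oppInt_iff : ∀ u ∈ hcpEquatorInt, ∀ w ∈ hcpInt,
    ((w ≠ u ∧ ¬ TouchInt 18 u w ∧ ∀ z ∈ hcpInt, TouchInt 18 u z → ¬ TouchInt 18 w z) ↔ w = -u) := by decide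

/-- The «no common toucher» clause is LOAD-BEARING: «other than `u` and not touching `u`» alone does not single out `−u`
(negative certificate; the positive attempt is must-fail M3). -/
theorem commonToucher_needed :
    ¬ (∀ u ∈ hcpEquatorInt, ∀ w ∈ hcpInt, w ≠ u → ¬ TouchInt 18 u w → w = -u) := by decide

/-- Each equatorial vector touches exactly TWO equatorial vectors (its `±60°` neighbours): the equator is a hexagon. -/
theorem card_equator_touching : ∀ u ∈ hcpEquatorInt, (hcpEquatorInt.filter fun w => TouchInt 18 u w).card = 2 := by
  decide

/-- … and exactly two polar vectors (one in each cap): in-layer valency `2 + 2 = 4` = the ring number. -/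
theorem card_polar_touching :
    ∀ u ∈ hcpEquatorInt, ((hcpInt \ hcpEquatorInt).filter fun w => TouchInt 18 u w).card = 2 := by decide

/-- THREE ROWS through a site: the six equatorial slots form three antipodal pairs. -/
theorem card_antipodal_pairs : (hcpEquatorInt.image fun u => ({u, -u} : Finset (Fin 3 → ℤ))).card = 3 := by decide

/-! ## §2 Slot occupants of a clean hcp-framed site -/

section slots

variable {θ : ℝ} {Q : PeriodicConfiguration 3} {p : Q.points} {A : E3 →ₗᵢ[ℝ] E3} {T : Finset E3}
  {e : ↥T ≃ ↥(hcpKissingPattern.image A)}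

-- `intVec_neg` (`intVec (-v) = -intVec v`, seat file) duplicates the landed `…DefectFreeCrystallizes.Negative.TypeGap.intVec_neg`
-- (dedup gate); it is inlined into `frame_neg` below instead of importing that unrelated module.

/-- A framed antipodal model vector is the antipode of the framed vector. -/
theorem frame_neg (A : E3 →ₗᵢ[ℝ] E3) (u : Fin 3 → ℤ) :
    A ((Real.sqrt (18 : ℕ))⁻¹ • intVec (-u)) = -A ((Real.sqrt (18 : ℕ))⁻¹ • intVec u) := by
  rw [show intVec (-u) = -intVec u from by ext i; simp [intVec], smul_neg, map_neg]

/-- ★ LABEL OF A NEAR SITE: in a `θ`-matched shell of a clean site (`θ ≤ 19/100`), a site within `θ` of the framed model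
vector `u` is a shell point (a bond neighbour) whose label under the matching IS `u` (`2θ < 1` = pattern separation). -/
theorem label_of_near (hT : (↑T : Set E3) = shellSet Q p) (he : ∀ t : ↥T, dist (t : E3) (e t : E3) ≤ θ)
    (hp : CleanAt Q θ p) (hθ : θ ≤ 19 / 100) {u : Fin 3 → ℤ} (hu : u ∈ hcpInt) {q : Q.points}
    (hq : dist (shellCoord Q p q) (A ((Real.sqrt (18 : ℕ))⁻¹ • intVec u)) ≤ θ) :
    ∃ hqT : shellCoord Q p q ∈ T, (e ⟨shellCoord Q p q, hqT⟩ : E3) = A ((Real.sqrt (18 : ℕ))⁻¹ • intVec u) := by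
  have hAv : ‖A ((Real.sqrt (18 : ℕ))⁻¹ • intVec u)‖ = 1 := by
    rw [A.norm_map]
    exact norm_eq_one_of_mem_hcpKissingPattern (Finset.mem_image_of_mem _ hu)
  have hc : 0 < nn Q p := Blocks.nearestDist_pt_pos Q p
  have hn1 : ‖shellCoord Q p q‖ ≤ 1 + θ := by
    have := norm_le_norm_add_norm_sub' (shellCoord Q p q) (A ((Real.sqrt (18 : ℕ))⁻¹ • intVec u))
    rw [hAv, ← dist_eq_norm] at this
    linarith
  have hn2 : 1 - θ ≤ ‖shellCoord Q p q‖ := by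
    have := norm_sub_norm_le (A ((Real.sqrt (18 : ℕ))⁻¹ • intVec u)) (shellCoord Q p q)
    rw [hAv, ← dist_eq_norm, dist_comm] at this
    linarith
  have hqp : q ≠ p := by
    intro h
    subst h
    have h0 : shellCoord Q q q = 0 := by simp [shellCoord]
    rw [h0, norm_zero] at hn2
    linarith
  have hqd : dist (p : E3) q ≤ 6 / 5 * nn Q p := by
    rw [dist_eq_nn_mul_norm_shellCoord]
    nlinarith
  have hpq : (bonds Q).Adj p q := gappedAt_of_chartedAt Q hp.1 hp.2 q hqp hqd
  have hqT : shellCoord Q p q ∈ T := (mem_shell_iff hT hp).2 hpq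
  refine ⟨hqT, ?_⟩
  by_contra hne
  have h1 : dist (shellCoord Q p q) (e ⟨_, hqT⟩ : E3) ≤ θ := he ⟨_, hqT⟩
  have hy : ((e ⟨_, hqT⟩ : ↥(hcpKissingPattern.image A)) : E3) ∈ hcpKissingPattern.image A := (e ⟨_, hqT⟩).2
  obtain ⟨y0, hy0, hy0e⟩ := Finset.mem_image.1 hy
  have hge : 1 ≤ dist (e ⟨_, hqT⟩ : E3) (A ((Real.sqrt (18 : ℕ))⁻¹ • intVec u)) := by
    rw [← hy0e, dist_frame]
    exact one_le_dist_of_mem_hcpKissingPattern hy0 (Finset.mem_image_of_mem _ hu)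
      (fun h => hne (by rw [← hy0e, h]))
  have hle : dist (e ⟨_, hqT⟩ : E3) (A ((Real.sqrt (18 : ℕ))⁻¹ • intVec u)) ≤ θ + θ :=
    (dist_triangle _ (shellCoord Q p q) _).trans (by rw [dist_comm] at h1; linarith)
  linarith

/-- ★ ONE SLOT PER OCCUPANT: a point within `θ` of two framed model vectors sees the same vector (`2θ < 1`). -/
theorem vec_eq_of_near (hθ : θ ≤ 19 / 100) {u u' : Fin 3 → ℤ} (hu : u ∈ hcpInt) (hu' : u' ∈ hcpInt) {x : E3}
    (hx : dist x (A ((Real.sqrt (18 : ℕ))⁻¹ • intVec u)) ≤ θ)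
    (hx' : dist x (A ((Real.sqrt (18 : ℕ))⁻¹ • intVec u')) ≤ θ) : u = u' := by
  by_contra hne
  have hne' : A ((Real.sqrt (18 : ℕ))⁻¹ • intVec u) ≠ A ((Real.sqrt (18 : ℕ))⁻¹ • intVec u') :=
    fun h => hne (scaledPattern_map_injective (by norm_num) (A.injective h))
  have h1 : 1 ≤ dist (A ((Real.sqrt (18 : ℕ))⁻¹ • intVec u)) (A ((Real.sqrt (18 : ℕ))⁻¹ • intVec u')) := by
    rw [dist_frame]
    exact one_le_dist_of_mem_hcpKissingPattern (Finset.mem_image_of_mem _ hu) (Finset.mem_image_of_mem _ hu')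
      (fun h => hne' (by rw [h]))
  have h2 : dist (A ((Real.sqrt (18 : ℕ))⁻¹ • intVec u)) (A ((Real.sqrt (18 : ℕ))⁻¹ • intVec u')) ≤ θ + θ :=
    (dist_triangle_left _ _ x).trans (add_le_add hx hx')
  linarith

/-- The vector-specific form of «every slot is occupied»: some site of `Q` sits within `θ` of each framed model vector
(the matching is onto; no cleanliness needed). -/
theorem exists_near_of_hcpFrame (hA : HcpFrame Q θ p A) {u : Fin 3 → ℤ} (hu : u ∈ hcpInt) :
    ∃ q : Q.points, dist (shellCoord Q p q) (A ((Real.sqrt (18 : ℕ))⁻¹ • intVec u)) ≤ θ := by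
  obtain ⟨T, hT, e, he⟩ := hA
  have hP : hcpKissingPattern = scaledPattern hcpInt 18 := rfl
  have hAv : A ((Real.sqrt (18 : ℕ))⁻¹ • intVec u) ∈ hcpKissingPattern.image A := frameVec_mem hP hu
  set t : ↥T := e.symm ⟨_, hAv⟩ with ht
  have htT : (t : E3) ∈ shellSet Q p := by rw [← hT]; exact t.2
  obtain ⟨q, -, -, hq⟩ := (mem_shellSet_iff Q).1 htT
  refine ⟨q, ?_⟩
  have h1 : dist (t : E3) (e t : E3) ≤ θ := he t
  rw [ht, Equiv.apply_symm_apply] at h1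
  rw [hq]
  simpa [ht] using h1

variable (hp : CleanAt Q θ p) (hA : HcpFrame Q θ p A) (hθ : θ ≤ 19 / 100)
include hp hA hθ

/-- A site in a slot is a bond neighbour. -/
theorem adj_of_near {u : Fin 3 → ℤ} (hu : u ∈ hcpInt) {q : Q.points}
    (hq : dist (shellCoord Q p q) (A ((Real.sqrt (18 : ℕ))⁻¹ • intVec u)) ≤ θ) : (bonds Q).Adj p q := by
  obtain ⟨T, hT, e, he⟩ := hA
  obtain ⟨hqT, -⟩ := label_of_near hT he hp hθ hu hq
  exact (mem_shell_iff hT hp).1 hqT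

/-- ★ ONE OCCUPANT PER SLOT: two sites within `θ` of the same framed model vector coincide (labels are injective). -/
theorem eq_of_near {u : Fin 3 → ℤ} (hu : u ∈ hcpInt) {q r : Q.points}
    (hq : dist (shellCoord Q p q) (A ((Real.sqrt (18 : ℕ))⁻¹ • intVec u)) ≤ θ)
    (hr : dist (shellCoord Q p r) (A ((Real.sqrt (18 : ℕ))⁻¹ • intVec u)) ≤ θ) : q = r := by
  obtain ⟨T, hT, e, he⟩ := hA
  obtain ⟨hqT, hlq⟩ := label_of_near hT he hp hθ hu hq
  obtain ⟨hrT, hlr⟩ := label_of_near hT he hp hθ hu hr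
  exact eq_of_label_eq hqT hrT hlq hlr rfl

/-- Occupants of slots `u, u'`: the SAME site iff the SAME slot. -/
theorem near_eq_iff {u u' : Fin 3 → ℤ} (hu : u ∈ hcpInt) (hu' : u' ∈ hcpInt) {q r : Q.points}
    (hq : dist (shellCoord Q p q) (A ((Real.sqrt (18 : ℕ))⁻¹ • intVec u)) ≤ θ)
    (hr : dist (shellCoord Q p r) (A ((Real.sqrt (18 : ℕ))⁻¹ • intVec u')) ≤ θ) : q = r ↔ u = u' := by
  constructor
  · intro h
    subst h
    exact vec_eq_of_near hθ hu hu' hq hr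
  · intro h
    subst h
    exact eq_of_near hp hA hθ hu hq hr

/-- ★★ THE HEXAGON LEMMA (link isomorphism restricted to slots): occupants of the slots `u, u'` of a clean hcp-framed
site are BONDED iff `u, u'` TOUCH.  With §1: occupants of adjacent equatorial slots are bonded, of the antipodal slot and of
the two `120°` slots are not — the six equatorial occupants induce a `6`-cycle. -/
theorem adj_iff_touchInt_of_near {u u' : Fin 3 → ℤ} (hu : u ∈ hcpInt) (hu' : u' ∈ hcpInt) {q r : Q.points}
    (hq : dist (shellCoord Q p q) (A ((Real.sqrt (18 : ℕ))⁻¹ • intVec u)) ≤ θ)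
    (hr : dist (shellCoord Q p r) (A ((Real.sqrt (18 : ℕ))⁻¹ • intVec u')) ≤ θ) :
    (bonds Q).Adj q r ↔ TouchInt 18 u u' := by
  obtain ⟨T, hT, e, he⟩ := hA
  have hP : hcpKissingPattern = scaledPattern hcpInt 18 := rfl
  obtain ⟨hqT, hlq⟩ := label_of_near hT he hp hθ hu hq
  obtain ⟨hrT, hlr⟩ := label_of_near hT he hp hθ hu' hr
  exact ⟨touchInt_of_adj modelFacts_hcp hT he hp hθ hqT hrT hu hlq hu' hlr,
    adj_of_touchInt hP modelFacts_hcp hT he hp hθ hqT hrT hu hlq hu' hlr⟩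

/-- Occupants of a slot and of its ANTIPODAL slot are distinct … -/
theorem ne_of_near_neg {u : Fin 3 → ℤ} (hu : u ∈ hcpEquatorInt) {q r : Q.points}
    (hq : dist (shellCoord Q p q) (A ((Real.sqrt (18 : ℕ))⁻¹ • intVec u)) ≤ θ)
    (hr : dist (shellCoord Q p r) (A ((Real.sqrt (18 : ℕ))⁻¹ • intVec (-u))) ≤ θ) : q ≠ r :=
  fun h => neg_ne_self_of_mem_hcpEquatorInt u hu
    ((near_eq_iff hp hA hθ (hcpEquatorInt_subset hu) (neg_mem_hcpInt u hu) hq hr).1 h).symm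

/-- … and NOT bonded. -/
theorem not_adj_of_near_neg {u : Fin 3 → ℤ} (hu : u ∈ hcpEquatorInt) {q r : Q.points}
    (hq : dist (shellCoord Q p q) (A ((Real.sqrt (18 : ℕ))⁻¹ • intVec u)) ≤ θ)
    (hr : dist (shellCoord Q p r) (A ((Real.sqrt (18 : ℕ))⁻¹ • intVec (-u))) ≤ θ) : ¬ (bonds Q).Adj q r :=
  fun h => not_touchInt_neg u hu
    ((adj_iff_touchInt_of_near hp hA hθ (hcpEquatorInt_subset hu) (neg_mem_hcpInt u hu) hq hr).1 h)

end slots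

/-! ## §3 Rows: the frame-free antipode relation and the row step -/

section rows

variable {θ : ℝ} {Q : PeriodicConfiguration 3}

/-- **ANTIPODES AT `q`**, read in the bond graph alone: `p` and `r` are bond neighbours of `q`, distinct, not bonded to each
other, and NO bond neighbour of `q` is bonded to both.  (In a clean shell: opposite vertices of the in-layer hexagon — §1's
certificate; the `120°` pairs fail the last clause.)  Symmetric in `p, r` by construction. -/
def IsAntipode (Q : PeriodicConfiguration 3) (q p r : Q.points) : Prop :=
  (bonds Q).Adj q p ∧ (bonds Q).Adj q r ∧ p ≠ r ∧ ¬ (bonds Q).Adj p r ∧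
    ∀ s : Q.points, (bonds Q).Adj q s → (bonds Q).Adj p s → ¬ (bonds Q).Adj r s

/-- Antipodality is symmetric. -/
theorem IsAntipode.symm {q p r : Q.points} (h : IsAntipode Q q p r) : IsAntipode Q q r p :=
  ⟨h.2.1, h.1, h.2.2.1.symm, fun h' => h.2.2.2.1 ((bonds Q).adj_symm h'),
    fun s hqs hrs hps => h.2.2.2.2 s hqs hps hrs⟩

/-- ★★★ THE FRAME READING OF ANTIPODES: at a clean hcp-framed site `q` (`θ ≤ 19/100`) with `p` in the equatorial slot `u`,
the antipodes of `p` at `q` are EXACTLY the occupants of the slot `−u`.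
(⟸: link isomorphism on the labels `u, −u, z` and §1.  ⟹: the label `w` of `r` is a shell vector `≠ u` (else `r = p`), not
touching `u` (else bonded), sharing no toucher with `u` (a common toucher's site would be a common bond neighbour) — so
`w = −u` by `oppInt_iff`.) -/
theorem isAntipode_iff_near_neg {q : Q.points} {A : E3 →ₗᵢ[ℝ] E3} (hq : CleanAt Q θ q) (hA : HcpFrame Q θ q A)
    (hθ : θ ≤ 19 / 100) {u : Fin 3 → ℤ} (hu : u ∈ hcpEquatorInt) {p : Q.points}
    (hp : dist (shellCoord Q q p) (A ((Real.sqrt (18 : ℕ))⁻¹ • intVec u)) ≤ θ) {r : Q.points} :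
    IsAntipode Q q p r ↔ dist (shellCoord Q q r) (A ((Real.sqrt (18 : ℕ))⁻¹ • intVec (-u))) ≤ θ := by
  have hP : hcpKissingPattern = scaledPattern hcpInt 18 := rfl
  have hM := modelFacts_hcp
  have huS : u ∈ hcpInt := hcpEquatorInt_subset hu
  have hnuS : -u ∈ hcpInt := neg_mem_hcpInt u hu
  have hA' := hA
  obtain ⟨T, hT, e, he⟩ := hA
  obtain ⟨hpT, hlp⟩ := label_of_near hT he hq hθ huS hp
  have hqp : (bonds Q).Adj q p := (mem_shell_iff hT hq).1 hpT
  constructor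
  · rintro ⟨-, hqr, hpr, hnadj, hno⟩
    have hrT : shellCoord Q q r ∈ T := (mem_shell_iff hT hq).2 hqr
    obtain ⟨w, hwS, hlw⟩ := exists_label hP (e ⟨_, hrT⟩)
    have hw : w = -u := by
      refine ((oppInt_iff u hu w hwS).1 ⟨?_, ?_, ?_⟩)
      · intro hwu
        exact hpr (eq_of_label_eq hpT hrT hlp hlw hwu.symm)
      · intro ht
        exact hnadj (adj_of_touchInt hP hM hT he hq hθ hpT hrT huS hlp hwS hlw ht)
      · intro z hzS htz htw
        obtain ⟨s, hqs, hs⟩ := exists_adj_of_mem_shell hT hq (e.symm ⟨_, frameVec_mem hP hzS⟩).2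
        have hsT : shellCoord Q q s ∈ T := (mem_shell_iff hT hq).2 hqs
        have hls : (e ⟨_, hsT⟩ : E3) = A ((Real.sqrt (18 : ℕ))⁻¹ • intVec z) := by
          have h1 : (⟨shellCoord Q q s, hsT⟩ : ↥T) = e.symm ⟨_, frameVec_mem hP hzS⟩ := Subtype.ext hs
          rw [h1, Equiv.apply_symm_apply]
        exact hno s hqs (adj_of_touchInt hP hM hT he hq hθ hpT hsT huS hlp hzS hls htz)
          (adj_of_touchInt hP hM hT he hq hθ hrT hsT hwS hlw hzS hls htw)
    subst hw
    have h1 : dist (shellCoord Q q r) (e ⟨_, hrT⟩ : E3) ≤ θ := he ⟨_, hrT⟩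
    rwa [hlw] at h1
  · intro hr
    obtain ⟨hrT, hlr⟩ := label_of_near hT he hq hθ hnuS hr
    have hqr : (bonds Q).Adj q r := (mem_shell_iff hT hq).1 hrT
    refine ⟨hqp, hqr, ne_of_near_neg hq hA' hθ hu hp hr, not_adj_of_near_neg hq hA' hθ hu hp hr, ?_⟩
    intro s hqs hps hrs
    have hsT : shellCoord Q q s ∈ T := (mem_shell_iff hT hq).2 hqs
    obtain ⟨z, hzS, hlz⟩ := exists_label hP (e ⟨_, hsT⟩)
    exact touchInt_neg_disjoint u hu z hzS (touchInt_of_adj hM hT he hq hθ hpT hsT huS hlp hzS hlz hps)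
      (touchInt_of_adj hM hT he hq hθ hrT hsT hnuS hlr hzS hlz hrs)

variable (hθ : θ ≤ 19 / 100)
include hθ

/-- A wall pair, read back in a frame: `q` has an hcp frame and `p` occupies one of its equatorial slots (layer
continuation (LC) of P-G). -/
theorem exists_frame_slot_of_wallAdj {p q : Q.points} (h : WallAdj θ Q p q) :
    ∃ A : E3 →ₗᵢ[ℝ] E3, HcpFrame Q θ q A ∧
      ∃ u ∈ hcpEquatorInt, dist (shellCoord Q q p) (A ((Real.sqrt (18 : ℕ))⁻¹ • intVec u)) ≤ θ := by
  obtain ⟨hp, hq, hpq⟩ := h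
  obtain ⟨A, hA, v, hv, hvp⟩ := (twinWallLaws_of_le hθ).1 hp hq hpq
  obtain ⟨u, hu, rfl⟩ := Finset.mem_image.1 hv
  exact ⟨A, hA, u, hu, hvp⟩

/-- … and in ANY hcp frame of `q` (one layer per site (FU) of P-G). -/
theorem exists_slot_of_wallAdj {p q : Q.points} (h : WallAdj θ Q p q) {A : E3 →ₗᵢ[ℝ] E3} (hA : HcpFrame Q θ q A) :
    ∃ u ∈ hcpEquatorInt, dist (shellCoord Q q p) (A ((Real.sqrt (18 : ℕ))⁻¹ • intVec u)) ≤ θ := by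
  obtain ⟨hp, hq, hpq⟩ := h
  obtain ⟨v, hv, hvp⟩ :=
    inSlot_of_equatorial (slotDictionary_of_le hθ) hq hA ((twinWallLaws_of_le hθ).1 hp hq hpq)
  obtain ⟨u, hu, rfl⟩ := Finset.mem_image.1 hv
  exact ⟨u, hu, hvp⟩

/-- ★★ ROW SUCCESSOR EXISTS: every wall pair `p q` has an antipode of `p` at `q`. -/
theorem exists_isAntipode {p q : Q.points} (h : WallAdj θ Q p q) : ∃ r : Q.points, IsAntipode Q q p r := by
  obtain ⟨A, hA, u, hu, hup⟩ := exists_frame_slot_of_wallAdj hθ h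
  obtain ⟨r, hr⟩ := exists_near_of_hcpFrame hA (neg_mem_hcpInt u hu)
  exact ⟨r, (isAntipode_iff_near_neg h.2.1 hA hθ hu hup).2 hr⟩

/-- ★★ … and is UNIQUE. -/
theorem isAntipode_unique {p q r r' : Q.points} (h : WallAdj θ Q p q) (hr : IsAntipode Q q p r)
    (hr' : IsAntipode Q q p r') : r = r' := by
  obtain ⟨A, hA, u, hu, hup⟩ := exists_frame_slot_of_wallAdj hθ h
  exact eq_of_near h.2.1 hA hθ (neg_mem_hcpInt u hu) ((isAntipode_iff_near_neg h.2.1 hA hθ hu hup).1 hr)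
    ((isAntipode_iff_near_neg h.2.1 hA hθ hu hup).1 hr')

/-- The successor occupies an equatorial slot of EVERY hcp frame of `q` … -/
theorem inSlot_of_isAntipode {p q r : Q.points} (h : WallAdj θ Q p q) {A : E3 →ₗᵢ[ℝ] E3} (hA : HcpFrame Q θ q A)
    (hr : IsAntipode Q q p r) : InSlot Q θ q r A := by
  obtain ⟨u, hu, hup⟩ := exists_slot_of_wallAdj hθ h hA
  exact ⟨_, Finset.mem_image_of_mem _ (neg_mem_hcpEquatorInt u hu), (isAntipode_iff_near_neg h.2.1 hA hθ hu hup).1 hr⟩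

/-- … so it is CO-LAYERED after `q`. -/
theorem equatorial_of_isAntipode {p q r : Q.points} (h : WallAdj θ Q p q) (hr : IsAntipode Q q p r) :
    Equatorial Q θ q r := by
  obtain ⟨A, hA, -⟩ := exists_frame_slot_of_wallAdj hθ h
  exact ⟨A, hA, inSlot_of_isAntipode hθ h hA hr⟩

/-- ★ A CLEAN successor continues the wall (completeness (E1) of P-G along the row). -/
theorem wallAdj_of_isAntipode {p q r : Q.points} (h : WallAdj θ Q p q) (hr : IsAntipode Q q p r) (hrc : CleanAt Q θ r) :
    WallAdj θ Q q r ∧ WallAdj θ Q r q := by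
  obtain ⟨A, hA, -⟩ := exists_frame_slot_of_wallAdj hθ h
  exact wallAdj_of_inSlot (slotDictionary_of_le hθ) (fccNoCis_of_le hθ) h.2.1 hA hrc (inSlot_of_isAntipode hθ h hA hr)

/-- ★★ (E3) ALONG ROWS — ROWS END ONLY AT UNCLEAN SITES: if the successor does not continue the wall it is not clean … -/
theorem not_cleanAt_of_row_end {p q r : Q.points} (h : WallAdj θ Q p q) (hr : IsAntipode Q q p r)
    (hend : ¬ WallAdj θ Q q r) : ¬ CleanAt Q θ r :=
  fun hrc => hend (wallAdj_of_isAntipode hθ h hr hrc).1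

/-- … i.e. CHARGED OR UNCHARTED (priced or gross matter: the species of parts A–K). -/
theorem charged_or_uncharted_of_row_end {p q r : Q.points} (h : WallAdj θ Q p q) (hr : IsAntipode Q q p r)
    (hend : ¬ WallAdj θ Q q r) : ¬ IsChargeFree (1 / 100) (Subtype.val : Q.points → E3) r ∨ ¬ ChartedAt θ Q r :=
  (not_cleanAt_iff Q).1 (not_cleanAt_of_row_end hθ h hr hend)

/-- ★★★ THE ROW DICHOTOMY (layer-row incidence, K-60a at Q-level): after every wall pair `p q` the row continues to a
UNIQUE site `r`, which is a wall site co-layered with `q` OR an unclean (charged or uncharted) site. -/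
theorem row_dichotomy {p q : Q.points} (h : WallAdj θ Q p q) :
    ∃ r : Q.points, IsAntipode Q q p r ∧ (∀ r', IsAntipode Q q p r' → r' = r) ∧
      (WallAdj θ Q q r ∨ ¬ CleanAt Q θ r) := by
  obtain ⟨r, hr⟩ := exists_isAntipode hθ h
  refine ⟨r, hr, fun r' hr' => isAntipode_unique hθ h hr' hr, ?_⟩
  by_cases hrc : CleanAt Q θ r
  · exact Or.inl (wallAdj_of_isAntipode hθ h hr hrc).1
  · exact Or.inr hrc

/-- The step BACK is a row step too: `p` is the antipode of `r` at `q` (symmetry), and if `r` is clean the pair `q r` is a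
wall pair from which the row continues (by `row_dichotomy` again) — rows are two-sided infinite or end at unclean sites. -/
theorem row_back {p q r : Q.points} (h : WallAdj θ Q p q) (hr : IsAntipode Q q p r) :
    IsAntipode Q q r p ∧ (CleanAt Q θ r → WallAdj θ Q q r) :=
  ⟨hr.symm, fun hrc => (wallAdj_of_isAntipode hθ h hr hrc).1⟩

end rows

end TwinRows

end Summit.AtomisticToContinuum.Crystallization.Theorems.ChargedEnergyGapChartDial
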